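import Summits.BirchSwinnertonDyer.BirchSwinnertonDyer.Theorems.PrintCf2SplitBadTwoDyadicTorsionOfModel
import Summits.BirchSwinnertonDyer.Rank1Residual.Additive.PadicLogFormalGroup
import Literature.NumberTheory.EllipticCurves.CanonicalPAdicHeightThetaProofs
import HarnessLib

set_option linter.dupNamespace false -- `…BirchSwinnertonDyer.BirchSwinnertonDyer…` is the cell's namespace (D-0017)
set_option autoImplicit false

/-!
# The DYADIC TORSION TABLE of the split-bad class, V: the stubs' local exponent `ℓ` —
# `ℓ ≥ 1` on the key `d ≡ 3 (mod 8)`, `ℓ ≥ 0` elsewhere, for EVERY point, in the verbatim currency of S2′ / S3b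

Cell `bsd-print-cf2`, width seat `bsd-line-cf2-p1-w4` g6 (`--supports stmt-BirchSwinnertonDyer-20368`, crux
`PrintCf2.SplitBadTwoRankOneOfFacts`, road α, skeleton of record v8). Theses-free; theorems only; no `sorry`. HONEST
FRAMING: 2-adic bookkeeping; nothing about `L`-values; BSD is not proved by any of this; no summit statement is proved here.

The registered stubs `stub_rubinValueFormula_two` (S2′) and `stub_ellipticUnitDescent_two` (S3b) read the Mordell–Weil
generator `P` of a rank-one member `W` through `c₀ ≠ 0`, `[c₀]P ∈ E₁(ℚ₂)` (`IsInReductionKernel`) and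
`‖log_Ŵ([c₀]P)/c₀‖ = 2^{−ℓ}`, and put `2ℓ` into the exponent `m` of `‖G(0)‖ = 2^{−m/2}`. By b2b-bsdres'
`padicLog_eq_padicLogPoint_nsmul_div` / `padicLogPoint_nsmul` that quotient IS `log_ω(P) = padicLog (W ⊗ ℚ₂) P`
(`padicLogPoint_nsmul_div_eq_padicLog`), which lies in `log_ω(W(ℚ₂)) = 2^{t−2}ℤ₂` (sibling IV,
`range_padicLog_two_of_smul_eq_quadraticTwist`). Hence **`ℓ ≥ 1` whenever `d ≡ 3 (mod 8)` and `ℓ ≥ 0` always**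
(`le_ell_of_smul_eq_quadraticTwist`), for every rational point and every admissible `c₀`; and the bound is attained by a
`ℚ₂`-point (`exists_norm_padicLog_eq`). For the generator, `ℓ − (t − 2) = ord₂ [W(ℚ₂)/tors : ℤ₂·P]` is the local index of
T3; so an explicit `e_A / e_B([d]₂)` in the index currency carries `+2` on `m` at the key `(1,3)`.

References: [SilvermanAEC2009] IV.6.4, VII.2.2, VII.6.3; [Kim2022StructureSelmer] §3.2.3, Lemma 3.10; [Serre1973] II §3.3 Thm 4.
-/

noncomputable section

open scoped Classical

open WeierstrassCurve Literature.NumberTheory.EllipticCurves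
open Summit.BirchSwinnertonDyer.Rank1Residual.Additive.LocalLog

namespace Summit.BirchSwinnertonDyer.BirchSwinnertonDyer.Theorems.PrintCf2.DyadicTorsion

variable {p : ℕ} [Fact p.Prime]

/-- **The stubs' quotient is `log_ω`**: for a `p`-integral elliptic `X/ℚ_p`, `Q ∈ X(ℚ_p)` and `c₀ ≠ 0` with
`[c₀]Q ∈ E₁(ℚ_p)`: `log_X̂(z([c₀]Q))/c₀ = padicLog X Q` (both equal `log_X̂(z([N c₀]Q))/(N c₀)`, `N = [E(ℚ_p) : E⁽²⁾(ℚ_p)]`).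
[cite: SilvermanAEC2009, IV.6.4 and VII.2.2] -/
theorem padicLogPoint_nsmul_div_eq_padicLog (X : WeierstrassCurve ℚ_[p]) [X.IsIntegral ℤ_[p]] [X.IsElliptic]
    (Q : X.toAffine.Point) {c₀ : ℕ} (hc₀ : c₀ ≠ 0) (hker : X.IsInReductionKernel (c₀ • Q)) :
    X.padicLogPoint (c₀ • Q) / (c₀ : ℚ_[p]) = padicLog X Q := by
  have hN : ((X.formalFiltration 2).index : ℚ_[p]) ≠ 0 :=
    Nat.cast_ne_zero.mpr (index_formalFiltration_two_ne_zero X)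
  have hc : (c₀ : ℚ_[p]) ≠ 0 := Nat.cast_ne_zero.mpr hc₀
  have h1 := padicLog_eq_padicLogPoint_nsmul_div X (c₀ • Q)
  rw [padicLogPoint_nsmul X hker, mul_div_cancel_left₀ _ hN, map_nsmul, nsmul_eq_mul] at h1
  rw [← h1, mul_div_cancel_left₀ _ hc]

/-- **`ℓ ≥ t − 2` IN THE STUBS' CURRENCY** — for every `d ≠ 0` squarefree with `d ≢ 1 (mod 4)`, every globally minimal
model `W` with `C • W = cm7.quadraticTwist d`, every `P ∈ W(ℚ)` and every `c₀ ≠ 0` with `[c₀]P ∈ E₁(ℚ₂)`: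
if `‖log_Ŵ([c₀]P)/c₀‖ = 2^{−ℓ}` then **`ℓ ≥ 1` when `d ≡ 3 (mod 8)`** (and `ℓ ≥ 0` otherwise), because
`log_ω(W(ℚ₂)) = 2^{t−2}ℤ₂` with `t = 3` exactly on that 2-adic key. [cite: Kim2022StructureSelmer, Lemma 3.10]
[cite: Serre1973, Ch. II §3.3 Thm 4] -/
theorem le_ell_of_smul_eq_quadraticTwist :
    ∀ (d : ℤ), d ≠ 0 → Squarefree d → d % 4 ≠ 1 →
    ∀ (W : WeierstrassCurve ℚ) [W.IsElliptic] [W.IsGloballyMinimal] (C : VariableChange ℚ),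
      C • W = cm7.quadraticTwist (d : ℚ) →
    ∀ (P : W.toAffine.Point) (c₀ : ℕ) (ℓ : ℤ), c₀ ≠ 0 →
      (W.baseChange ℚ_[2]).IsInReductionKernel (c₀ • W.toPadicPoint 2 P) →
      ‖(W.baseChange ℚ_[2]).padicLogPoint (c₀ • W.toPadicPoint 2 P) / (c₀ : ℚ_[2])‖ = (2 : ℝ) ^ (-ℓ) →
      (if d % 8 = 3 then (1 : ℤ) else 0) ≤ ℓ := by
  intro d _ hsq hd4 W _ _ C hC P c₀ ℓ hc₀ hker hnorm
  set X := W.baseChange ℚ_[2] with hX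
  set e : ℤ := if d % 8 = 3 then 1 else 0 with he
  rw [padicLogPoint_nsmul_div_eq_padicLog X (W.toPadicPoint 2 P) hc₀ hker] at hnorm
  have hmem : padicLog X (W.toPadicPoint 2 P) ∈ (padicLog X).range := ⟨_, rfl⟩
  rw [range_padicLog_two_of_smul_eq_quadraticTwist hsq hd4 W hC, Submodule.mem_toAddSubgroup,
    Submodule.mem_span_singleton] at hmem
  obtain ⟨c, hc⟩ := hmem
  have hle : ‖padicLog X (W.toPadicPoint 2 P)‖ ≤ (2 : ℝ) ^ (-e) := by
    rw [← hc, Algebra.smul_def, norm_mul, show (algebraMap ℤ_[2] ℚ_[2]) c = (c : ℚ_[2]) from rfl,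
      ← PadicInt.norm_def]
    have h2 : ‖(2 : ℚ_[2]) ^ e‖ = (2 : ℝ) ^ (-e) := by exact_mod_cast Padic.norm_p_zpow (p := 2) e
    rw [h2]
    have := PadicInt.norm_le_one c
    have h0 : 0 ≤ (2 : ℝ) ^ (-e) := by positivity
    nlinarith
  rw [hnorm] at hle
  exact neg_le_neg_iff.mp ((zpow_le_zpow_iff_right₀ (by norm_num : (1 : ℝ) < 2)).mp hle)

/-- … and the bound is sharp over `ℚ₂`: some point of `W(ℚ₂)` has `‖log_ω‖ = 2^{−(t−2)}` (`2^{t−2}` generates the image).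
[cite: Kim2022StructureSelmer, Lemma 3.10] -/
theorem exists_norm_padicLog_eq {d : ℤ} (hsq : Squarefree d) (hd4 : d % 4 ≠ 1)
    (W : WeierstrassCurve ℚ) [W.IsElliptic] [W.IsGloballyMinimal] {C : VariableChange ℚ}
    (hC : C • W = cm7.quadraticTwist (d : ℚ)) :
    ∃ Q : (W.baseChange ℚ_[2]).toAffine.Point,
      ‖padicLog (W.baseChange ℚ_[2]) Q‖ = (2 : ℝ) ^ (-(if d % 8 = 3 then (1 : ℤ) else 0)) := by
  set e : ℤ := if d % 8 = 3 then 1 else 0 with he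
  have hmem : (2 : ℚ_[2]) ^ e ∈ (padicLog (W.baseChange ℚ_[2])).range := by
    rw [range_padicLog_two_of_smul_eq_quadraticTwist hsq hd4 W hC, Submodule.mem_toAddSubgroup]
    exact Submodule.mem_span_singleton_self _
  obtain ⟨Q, hQ⟩ := hmem
  have h2 : ‖(2 : ℚ_[2]) ^ e‖ = (2 : ℝ) ^ (-e) := by exact_mod_cast Padic.norm_p_zpow (p := 2) e
  exact ⟨Q, by rw [hQ, h2]⟩

end Summit.BirchSwinnertonDyer.BirchSwinnertonDyer.Theorems.PrintCf2.DyadicTorsion
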